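import Mathlib
import HarnessLib
import Summits.HubbardSuperconductivity.HubbardSuperconductivity.Theorems.KLProgrammeKLRegimeEngineTowerInstRemeasureLev

/-!
# Route `KLProgramme` — crux K3 ENGINE (stmt-HubbardSuperconductivity-20437 `KLRegimeEngineV17F2`), stub (b) v2, THE LEVELS PACKAGE (ℓ), instantiation (I2):
# THE LEVELLED `hμ` ROW IN THE KIT'S LITERAL TWO-ROW SHAPE, tracks `F ≥ 2` (located item «(I2)-KIT-HMU-LEV», UNITS-MAP §(1)–(3); cell gate-hubbard-kl, seat p4 g17)

`klTowerMuLevAt_le_kitSum` (…InstRemeasureLev) bounds the per-track measured array by a UV term plus a sum over the born blocks in rate form.  Here the same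
bound is rewritten LITERALLY as the first row of the kit's `hμ` (`towerBorn_le_law_tracks`):
`μ_t k p ≤ Σ_{k′ ∈ range (k+1)} c₁(t)·c₂^p·r^{(2p − bo_t)(k+1−k′)}·b t k′ p` with
`r = ((√2)^d)⁻¹` (`= √g`), `a_t = 2`, **`bo_t = 6 − t`**, `c₂ = 2·C₂²`, `c₁(t) = 27^{t+1}·C₁·(√2)^t/(8·C₂)`, `b t k′ p = klTowerBLev … d t k′ p` for `k′ ≥ 1` and the
VIRTUAL UV datum `b t 0 p = (√2)^{(2p+t−6)·d}·N₀(t,p)/klLevUnit … t p 0` (E1 blueprint §1 (α): the level-0 law then has to be `≤ A λ^{p−1} Q^p` in these virtual units —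
(I3)); the on-class row (`c₃`) is not needed for these tracks (`c₃ = 0`).  Admissible for the kit (`bo_t + 1 ≤ 3a_t = 6`) exactly for `t ≥ 1` (`F ≥ 2`).

* `kitConsts_identity` — `c₁(t)·c₂^p = 27^{t+1}·C₁·C₂^{2p−1}·(√2)^{2p+t−6}` (`p ≥ 3`);
* **`klTowerMuLevAt_le_hμRow`** — the literal first-row shape above, for every `t : Fin 5`, `p ≥ 3`, under the binders of `klTowerMuLevAt_le_kitSum`.
Real algebra over a landed theorem; nothing about the model is asserted beyond it; nothing asserts (ℓ), any stub, K3 or superconductivity.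
References: BGM 2006 §2.8 (2.83), (2.93)–(2.98) [cite: BenfattoGiulianiMastropietro2006].
-/

noncomputable section

namespace Summit.HubbardSuperconductivity.HubbardSuperconductivity.Theorems.EngineV8

set_option linter.dupNamespace false -- summit = problem name (single-conjunct summit), D-0017

open Classical
open Real Finset Literature.MathematicalPhysics.QuantumLattice Literature.Probability.LatticeModels GrassmannAlgebra
open Literature.MathematicalPhysics.QuantumLattice.FermiRG
open Summit.HubbardSuperconductivity.HubbardSuperconductivity.Theorems.KLProgrammeLegKernels
open Summit.HubbardSuperconductivity.HubbardSuperconductivity.Theorems.KLRegimeSplit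
open Summit.HubbardSuperconductivity.HubbardSuperconductivity.Theorems.KLRegimeWick
open Summit.HubbardSuperconductivity.HubbardSuperconductivity.Theorems.TorusFourierL2
open Summit.HubbardSuperconductivity.HubbardSuperconductivity.Theorems.DispersionFlow
open Summit.HubbardSuperconductivity.HubbardSuperconductivity.Theorems.PerturbedFermiCurve

/-! ## §1 The kit constants -/

/-- **The kit constants reproduce the row's prefactor**: `(27^{t+1}·C₁·(√2)^t/(8C₂))·(2C₂²)^{q+3} = 27^{t+1}·C₁·C₂^{2(q+3)−1}·(√2)^{2(q+3)+t−6}` (`C₂ > 0`). -/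
theorem kitConsts_identity {C₁ C₂ : ℝ} (hC₂ : 0 < C₂) (t q : ℕ) :
    (27 : ℝ) ^ (t + 1) * C₁ * Real.sqrt 2 ^ t / (8 * C₂) * (2 * C₂ ^ 2) ^ (q + 3) =
      (27 : ℝ) ^ (t + 1) * C₁ * C₂ ^ (2 * (q + 3) - 1) * Real.sqrt 2 ^ (2 * (q + 3) + t - 6) := by
  have hs2 : Real.sqrt 2 ^ (2 * (q + 3) + t - 6) = 2 ^ q * Real.sqrt 2 ^ t := by
    rw [show 2 * (q + 3) + t - 6 = 2 * q + t by omega, pow_add, ← two_pow_eq_sqrt_two_pow]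
  have hC : C₂ ^ (2 * (q + 3) - 1) = C₂ ^ (2 * q + 5) := by rw [show 2 * (q + 3) - 1 = 2 * q + 5 by omega]
  rw [hs2, hC, mul_pow, show (q + 3) = q + 3 from rfl, pow_add, pow_add, ← pow_mul]
  field_simp
  ring

/-! ## §2 The literal first row of `hμ` for the levelled tracks -/

variable {L M : ℕ} [NeZero L] [NeZero M]

omit [NeZero L] [NeZero M] in
/-- **THE LEVELLED `hμ` ROW IN THE KIT'S LITERAL SHAPE** (one-determined-leg count; admissible for the tracks `t ≥ 1`): with the constants `C₁, C₂` and thresholds of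
`klTowerMuLevAt_le_kitSum` (fixed before the degree), for every `t : Fin 5`, `p ≥ 3`, `d ≥ 2`, `k ≥ 1`, `dk − 1 ≤ nScales β + 1` and every level-0 bound `N₀`,
`klTowerMuLevAt … d t k p ≤ Σ_{k′ ∈ range (k+1)} c₁(t)·c₂^p·(((√2)^d)⁻¹)^{(2p − (6 − t))·(k+1−k′)}·b k′`,
`b 0 = (√2)^{(2p+t−6)d}·N₀/klLevUnit … t p 0` (virtual UV datum), `b k′ = klTowerBLev … d t k′ p` (`k′ ≥ 1`).
[cite: BenfattoGiulianiMastropietro2006, §2.8 (2.83), (2.93)-(2.98)] -/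
theorem klTowerMuLevAt_le_hμRow :
    ∃ C₁ C₂ : ℝ, 0 < C₁ ∧ 0 < C₂ ∧ ∀ R : RenConsts, R.WF2 → ∃ c₃' : ℝ, 0 < c₃' ∧ ∃ U₀' : ℝ, 0 < U₀' ∧
      ∀ (P : SplitConsts) (c : ℝ), P.WF → 0 < c → c ≤ klEngC₃6 P R → c ≤ c₃' →
      ∀ μ ∈ klWindowC, ∀ U : ℝ, 0 < U → U ≤ klEngU₀9 P R c → U ≤ U₀' → ∀ β : ℝ, klBetaMin ≤ β → β ≤ Real.exp (c / U ^ 2) →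
      ∀ K : TrigPolyC4v, FrameOK R U (nScales β) μ K → ∀ (L M : ℕ) [NeZero L] [NeZero M],
      klEngL₃ β U ≤ L → klEngM₃ β U L ≤ M → ∀ d k : ℕ, 2 ≤ d → 1 ≤ k → d * k - 1 ≤ nScales β + 1 →
      ∀ (t : Fin 5) (p : ℕ), 3 ≤ p → ∀ N₀ : ℝ, 0 ≤ N₀ →
        (∀ Ωe' : Fin (2 * p) → Option (SectorLeg (sectorCount 0)), levelCount Ωe' = (t : ℕ) + 1 →
          klAnisoLegKernelNormAt L M β U μ K klE0 0 (2 * p) Ωe' ≤ N₀) →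
        klTowerMuLevAt L M β U μ K d t k p ≤
          ∑ k' ∈ range (k + 1), ((27 : ℝ) ^ ((t : ℕ) + 1) * C₁ * Real.sqrt 2 ^ (t : ℕ) / (8 * C₂)) * (2 * C₂ ^ 2) ^ p *
            ((Real.sqrt 2 ^ d)⁻¹) ^ ((2 * p - (6 - (t : ℕ))) * (k + 1 - k')) *
            (if k' = 0 then Real.sqrt 2 ^ ((2 * p + (t : ℕ) - 6) * d) * (N₀ / klLevUnit β M t p 0) else klTowerBLev L M β U μ K d t k' p) := by
  obtain ⟨C₁, C₂, hC₁, hC₂, h⟩ := klTowerMuLevAt_le_kitSum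
  refine ⟨C₁, C₂, hC₁, hC₂, fun R hR2 => ?_⟩
  obtain ⟨c₃, hc₃, U₀, hU₀, h'⟩ := h R hR2
  refine ⟨c₃, hc₃, U₀, hU₀, ?_⟩
  intro P c hP hc hc6 hc₃' μ hμ U hU hU9 hU₀' β hβmin hβc K hK L M _ _ hL3 hM3 d k hd hk1 hkN t p hp N₀ hN0 hN
  have ht : (t : ℕ) ≤ 4 := by have := t.isLt; omega
  have hmain := h' P c hP hc hc6 hc₃' μ hμ U hU hU9 hU₀' β hβmin hβc K hK L M hL3 hM3 d k hd hk1 hkN t p (by omega) (by omega) N₀ hN0 hN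
  refine hmain.trans (le_of_eq ?_)
  obtain ⟨q, rfl⟩ : ∃ q, p = q + 3 := ⟨p - 3, by omega⟩
  have hs : 0 < Real.sqrt 2 := Real.sqrt_pos.2 (by norm_num)
  have hsd : (Real.sqrt 2 ^ d) ≠ 0 := by positivity
  have hE : 2 * (q + 3) - (6 - (t : ℕ)) = 2 * q + (t : ℕ) := by omega
  have hE' : 2 * (q + 3) + (t : ℕ) - 6 = 2 * q + (t : ℕ) := by omega
  have hconst := kitConsts_identity (C₁ := C₁) hC₂ (t : ℕ) q
  rw [hE, hE'] at *
  rw [sum_range_succ', mul_add, Finset.mul_sum, add_comm]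
  simp only [Nat.succ_ne_zero, if_false, if_true, Nat.add_sub_add_right, Nat.sub_zero]
  have hdk : 1 ≤ d * k := le_trans (by norm_num) (Nat.mul_le_mul hd hk1)
  have hexp : d * ((2 * q + (t : ℕ)) * (k + 1)) = (2 * q + (t : ℕ)) * (d * k - 1) + (2 * q + (t : ℕ)) * d + (2 * q + (t : ℕ)) := by
    zify [hdk]; ring
  have hkey : (Real.sqrt 2 ^ (2 * q + (t : ℕ)))⁻¹ ^ (d * k - 1) =
      ((Real.sqrt 2 ^ d)⁻¹) ^ ((2 * q + (t : ℕ)) * (k + 1)) * Real.sqrt 2 ^ ((2 * q + (t : ℕ)) * d) * Real.sqrt 2 ^ (2 * q + (t : ℕ)) := by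
    rw [inv_pow, inv_pow, ← pow_mul, ← pow_mul, hexp, pow_add, pow_add]
    field_simp
  congr 1
  · refine sum_congr rfl fun k' hk' => ?_
    rw [hconst]; ring
  · rw [hconst, hkey]; ring

end Summit.HubbardSuperconductivity.HubbardSuperconductivity.Theorems.EngineV8

end
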